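import Mathlib
import Summits.Schanuel.Schanuel.Theses.RootDecomp1E
import Summits.Schanuel.Schanuel.Theorems.RootDecomp1EAnchorToolkit
import Summits.Schanuel.Schanuel.Theorems.RootDecomp1EEStableRung
import Summits.Schanuel.Schanuel.Theorems.RootDecomp1EModuleGrids
import Summits.Schanuel.Schanuel.Theorems.RootDecomp1EModuleType
import Summits.Schanuel.Schanuel.Theorems.RootDecomp1EModuleTypeEngines
import Literature.Barriers.Schanuel.LargeTranscendenceDegree
import Literature.Barriers.Schanuel.NesterenkoModularScope
import Literature.NumberTheory.Transcendental.PeriodsWave0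
import Literature.NumberTheory.Transcendental.LindemannWeierstrassProofs

-- `Summit.Schanuel.Schanuel.…` is the mandated layout of this single-problem summit (CONVENTIONS §1).
set_option linter.dupNamespace false

/-!
# RootDecomp1E — lens 2, gen 10 «EngineType» (part 1/2): the engine-complete special class, the TEETH theorem,
# the layer-exact residual

THEOREM ROUND on `route-Schanuel-RootDecomp1E` (no new items; supports the residual `RootDecomp1E.PlainDefectOne`,
stmt-Schanuel-31410, and refines round 9's `Theorems.RootDecomp1EModuleType{,Engines}`).

(A) ENGINE TYPE.  `z` is ENGINE-RICH iff (M) `ModuleRich z` (round 9: a Thm 2.9 / Brownawell–Waldschmidt grid in the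
exponential module of `F_z = ℚ(z, e^z)`), or (L) LINDEMANN–WEIERSTRASS: two ℚ-free algebraic `b₁, b₂` with `e^{b_k}`
algebraic over `F_z`, or (N) NESTERENKO: `π` and (`e^π` or `e^{π√3}`) algebraic over `F_z` — the union of the
hypothesis domains of every PROVED exponential engine of the tree with output `trdeg ≥ 2`; ENGINE-DARK otherwise.
`S⁻ ⟺ (∀ n, EngineRichDefectOneAt n) ∧ (∀ n, EngineDarkDefectOneAt n)` (`defectOne_iff_engineRichAt_engineDarkAt`,
an instance of the generic TYPE-SPLIT SCHEMA `defectOne_iff_typeSplit`); the rich layers are DECIDED for `n ≤ 3`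
(`engineRichDefectOneAt_le_three`, mod the proved tree facts `smallTrdeg_thm_2_9_two_two`, `smallTrdeg_thm_2_9_pos`,
`nesterenko`, `nesterenko'` — hypothesis form only because their cones have no farm olean; (L) is hypothesis-free);
dictionary: rich layers ⟹ round 9's `RichDefectOneAt`, and `PlainDefectOne ⟹ (∀ n, PoorDefectOneAt n) ⟹` dark layers.
(B) TEETH (hypothesis-free): at a sub-minimal ℚ-free tuple of length `n ≥ 4`, `trdeg F_z ≥ 2` follows from
sub-minimality alone (`two_le_trdeg_of_subMinimal`), and an `S⁻`-failure there has `trdeg F_z = n − 2` exactly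
(`trdeg_add_two_eq_of_firstFailure`): every engine with output `trdeg ≥ 2` is INERT from length 4 on.
(C) LAYER-EXACT RESIDUAL: `S⁻ ⟺ EngineDarkDefectOneAt 3 ∧ ∀ n ≥ 4, FirstFailureLayer n`
(`defectOne_iff_darkThree_and_fromFour`).  Part 2/2 (`Theorems.RootDecomp1EEngineTypeCells`): the certified literal
members `(iπ, 1, i)` and `(π, 1, iπ)` of 31410's first open layer decided by (L), (N).
Sorry-free; axioms `propext`, `Classical.choice`, `Quot.sound`.
[cite: NesterenkoPhilippon2001, Ch. 14 Thm 2.9; Ch. 3 Cor. 1.2] [cite: BakerTNT1975, Ch. 1 Thm 1.4] [cite: Nesterenko1996SbMath]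
-/

noncomputable section

namespace Summit.Schanuel.Schanuel.Theorems.RootDecomp1EEngineType

open Complex IntermediateField
open Summit.Schanuel.Schanuel.Theses.RootDecomp1E (DefectOneSchanuel EStableDefectOne PlainDefectOne)
open Summit.Schanuel.Schanuel.Theorems.RootDecomp1EAnchor (isAlgebraic_of_mem_adjoin
  trdeg_adjoin_le_of_isAlgebraic mem_adjoin_of_mem_span exp_isAlgebraic_of_mem_span isAlgebraic_transfer
  trdeg_adjoin_le_nat trdeg_le_of_mem_span exists_nat_eq_of_le_natCast span_range_le)
open Summit.Schanuel.Schanuel.Theorems.RootDecomp1EEStableRung (defectOne_of_le_two)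
open Summit.Schanuel.Schanuel.Theorems.RootDecomp1EModuleGrids (subMinimal_three rat_mul_pi_eq_rat)
open Summit.Schanuel.Schanuel.Theorems.RootDecomp1EModuleType (ModuleRich SubMinimalDefect RichDefectOneAt
  PoorDefectOneAt defectOne_iff_richAt_poorAt moduleRich_of_span_le two_le_trdeg_of_moduleRich
  poorAt_of_plainDefectOne plain_of_not_moduleRich eStableDefectOne_of_richAt)
open Literature.Barriers.Schanuel (smallTrdeg_thm_2_9_pos smallTrdeg_thm_2_9_two_two isAlgebraic_I
  linearIndependent_one_piI)
open Literature.NumberTheory.Transcendental (nesterenko nesterenko' algebraicIndependent_exp_holds)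

/-! ## §1 Vocabulary -/

/-- (L) LINDEMANN–WEIERSTRASS-RICH: two ℚ-free ALGEBRAIC points of the exponential module of `F_z`. -/
def LWRich {ι : Type*} (z : ι → ℂ) : Prop :=
  ∃ b : Fin 2 → ℂ, LinearIndependent ℚ b ∧ (∀ k, IsAlgebraic ℚ (b k)) ∧
    ∀ k, IsAlgebraic ↥(IntermediateField.adjoin ℚ (Set.range z ∪ Set.range (Complex.exp ∘ z))) (Complex.exp (b k))

/-- (N) NESTERENKO-RICH: `π` and (`e^π` or `e^{π√3}`) are algebraic over `F_z`. -/
def PeriodRich {ι : Type*} (z : ι → ℂ) : Prop :=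
  IsAlgebraic ↥(IntermediateField.adjoin ℚ (Set.range z ∪ Set.range (Complex.exp ∘ z))) (Real.pi : ℂ) ∧
    (IsAlgebraic ↥(IntermediateField.adjoin ℚ (Set.range z ∪ Set.range (Complex.exp ∘ z)))
        (Complex.exp (Real.pi : ℂ)) ∨
      IsAlgebraic ↥(IntermediateField.adjoin ℚ (Set.range z ∪ Set.range (Complex.exp ∘ z)))
        (Complex.exp ((Real.pi : ℂ) * (Real.sqrt 3 : ℂ))))

/-- ENGINE-RICH = module-rich ∨ LW-rich ∨ Nesterenko-rich; ENGINE-DARK = its negation. -/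
def EngineRich {ι : Type*} (z : ι → ℂ) : Prop := ModuleRich z ∨ LWRich z ∨ PeriodRich z

/-- `S⁻` at engine-rich sub-minimal ℚ-free tuples of length `n`. -/
def EngineRichDefectOneAt (n : ℕ) : Prop :=
  ∀ (z : Fin n → ℂ), LinearIndependent ℚ z → EngineRich z → SubMinimalDefect n z →
    (n : Cardinal) ≤ Algebra.trdeg ℚ ↥(IntermediateField.adjoin ℚ (Set.range z ∪ Set.range (Complex.exp ∘ z))) + 1

/-- `S⁻` at engine-dark sub-minimal ℚ-free tuples of length `n` (the layers of the round-10 residual). -/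
def EngineDarkDefectOneAt (n : ℕ) : Prop :=
  ∀ (z : Fin n → ℂ), LinearIndependent ℚ z → ¬ EngineRich z → SubMinimalDefect n z →
    (n : Cardinal) ≤ Algebra.trdeg ℚ ↥(IntermediateField.adjoin ℚ (Set.range z ∪ Set.range (Complex.exp ∘ z))) + 1

/-- TYPE-FREE layer: `S⁻` at every sub-minimal ℚ-free tuple of length `n`. -/
def FirstFailureLayer (n : ℕ) : Prop :=
  ∀ (z : Fin n → ℂ), LinearIndependent ℚ z → SubMinimalDefect n z →
    (n : Cardinal) ≤ Algebra.trdeg ℚ ↥(IntermediateField.adjoin ℚ (Set.range z ∪ Set.range (Complex.exp ∘ z))) + 1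

/-! ## §2 The type-split schema, exactness, dictionary, field invariance -/

/-- **TYPE-SPLIT SCHEMA**: for ANY predicate `P` on tuples, `S⁻ ⟺ (P-layers) ∧ (¬P-layers)` at sub-minimal first
failures (strong induction on the length, then excluded middle on `P z`). -/
theorem defectOne_iff_typeSplit (P : ∀ {n : ℕ}, (Fin n → ℂ) → Prop) :
    DefectOneSchanuel ↔
      (∀ (n : ℕ) (z : Fin n → ℂ), LinearIndependent ℚ z → P z → SubMinimalDefect n z →
        (n : Cardinal) ≤ Algebra.trdeg ℚ ↥(adjoin ℚ (Set.range z ∪ Set.range (cexp ∘ z))) + 1) ∧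
      (∀ (n : ℕ) (z : Fin n → ℂ), LinearIndependent ℚ z → ¬ P z → SubMinimalDefect n z →
        (n : Cardinal) ≤ Algebra.trdeg ℚ ↥(adjoin ℚ (Set.range z ∪ Set.range (cexp ∘ z))) + 1) := by
  refine ⟨fun hD => ⟨fun n z hz _ _ => hD n z hz, fun n z hz _ _ => hD n z hz⟩, fun ⟨hP, hN⟩ n => ?_⟩
  induction n using Nat.strong_induction_on with
  | _ n ih =>
    intro z hz
    have hsub : SubMinimalDefect n z := fun m w hm hw _ => ih m hm w hw
    by_cases hPz : P z
    · exact hP n z hz hPz hsub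
    · exact hN n z hz hPz hsub

/-- `S⁻` is the conjunction of its type-free first-failure layers. -/
theorem defectOne_iff_layers : DefectOneSchanuel ↔ ∀ n, FirstFailureLayer n := by
  refine ⟨fun hD n z hz _ => hD n z hz, fun h n => ?_⟩
  induction n using Nat.strong_induction_on with
  | _ n ih =>
    intro z hz
    exact h n z hz (fun m w hm hw _ => ih m hm w hw)

/-- **EXACTNESS of the round-10 cut.** -/
theorem defectOne_iff_engineRichAt_engineDarkAt :
    DefectOneSchanuel ↔ (∀ n, EngineRichDefectOneAt n) ∧ (∀ n, EngineDarkDefectOneAt n) :=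
  (defectOne_iff_typeSplit (fun z => EngineRich z)).trans
    ⟨fun ⟨h₁, h₂⟩ => ⟨fun n z hz hr hs => h₁ n z hz hr hs, fun n z hz hr hs => h₂ n z hz hr hs⟩,
      fun ⟨h₁, h₂⟩ => ⟨fun n z hz hr hs => h₁ n z hz hr hs, fun n z hz hr hs => h₂ n z hz hr hs⟩⟩

/-- The glue in its natural order. -/
theorem defectOne_of_engineRichAt_of_engineDarkAt (hR : ∀ n, EngineRichDefectOneAt n)
    (hD : ∀ n, EngineDarkDefectOneAt n) : DefectOneSchanuel :=
  defectOne_iff_engineRichAt_engineDarkAt.mpr ⟨hR, hD⟩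

/-- A first-failure layer is the conjunction of its rich and dark halves. -/
theorem firstFailureLayer_iff_rich_and_dark (n : ℕ) :
    FirstFailureLayer n ↔ EngineRichDefectOneAt n ∧ EngineDarkDefectOneAt n := by
  refine ⟨fun h => ⟨fun z hz _ hs => h z hz hs, fun z hz _ hs => h z hz hs⟩, fun ⟨hR, hD⟩ z hz hs => ?_⟩
  by_cases hr : EngineRich z
  · exact hR z hz hr hs
  · exact hD z hz hr hs

/-- DICTIONARY: rich layers of round 10 CONTAIN round 9's. -/
theorem richAt_of_engineRichAt {n : ℕ} (hR : EngineRichDefectOneAt n) : RichDefectOneAt n :=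
  fun z hz hrich hsub => hR z hz (Or.inl hrich) hsub

/-- … hence imply round 7's `EStableDefectOne` (stmt-Schanuel-31409). -/
theorem eStableDefectOne_of_engineRichAt (hR : ∀ n, EngineRichDefectOneAt n) : EStableDefectOne :=
  eStableDefectOne_of_richAt fun n => richAt_of_engineRichAt (hR n)

/-- DICTIONARY: round 9's poor layers IMPLY round 10's dark layers. -/
theorem engineDarkAt_of_poorAt {n : ℕ} (hP : PoorDefectOneAt n) : EngineDarkDefectOneAt n :=
  fun z hz hdark hsub => hP z hz (fun hrich => hdark (Or.inl hrich)) hsub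

/-- DICTIONARY: the live residual `PlainDefectOne` (stmt-Schanuel-31410) IMPLIES every dark layer. -/
theorem engineDarkAt_of_plainDefectOne (hP : PlainDefectOne) (n : ℕ) : EngineDarkDefectOneAt n :=
  engineDarkAt_of_poorAt (poorAt_of_plainDefectOne hP n)

/-- An engine-dark ℚ-free tuple of length `≥ 3` is PLAIN. -/
theorem plain_of_engineDark {n : ℕ} (hn : 3 ≤ n) {z : Fin n → ℂ} (hz : LinearIndependent ℚ z)
    (hdark : ¬ EngineRich z) :
    ∀ β : ℂ, IsAlgebraic ℚ β → (∀ i, β * z i ∈ Submodule.span ℚ (Set.range z)) → β ∈ Set.range (algebraMap ℚ ℂ) :=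
  plain_of_not_moduleRich hn hz (fun h => hdark (Or.inl h))

/-- FIELD INVARIANCE: engine-richness depends on `z` only through `F_z^{alg}`. -/
theorem engineRich_of_span_le {ι κ : Type*} {z : ι → ℂ} {w : κ → ℂ}
    (h : ∀ k, z k ∈ Submodule.span ℚ (Set.range w)) (hz : EngineRich z) : EngineRich w := by
  rcases hz with hM | ⟨b, hb, halg, hbF⟩ | ⟨hπ, hE⟩
  · exact Or.inl (moduleRich_of_span_le h hM)
  · exact Or.inr (Or.inl ⟨b, hb, halg, fun k => isAlgebraic_transfer h (hbF k)⟩)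
  · refine Or.inr (Or.inr ⟨isAlgebraic_transfer h hπ, ?_⟩)
    rcases hE with h1 | h3
    · exact Or.inl (isAlgebraic_transfer h h1)
    · exact Or.inr (isAlgebraic_transfer h h3)

/-! ## §3 The engines: every clause of ENGINE-RICH gives `trdeg F_z ≥ 2`; the rich layers are DECIDED for `n ≤ 3` -/

/-- Two algebraically independent elements of an intermediate field give it transcendence degree `≥ 2`. -/
theorem two_le_trdeg_of_algebraicIndependent {L : IntermediateField ℚ ℂ} {v : Fin 2 → ℂ}
    (hv : AlgebraicIndependent ℚ v) (hmem : ∀ i, v i ∈ L) : (2 : Cardinal) ≤ Algebra.trdeg ℚ ↥L := by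
  let y : Fin 2 → ↥L := fun i => ⟨v i, hmem i⟩
  have hy : AlgebraicIndependent ℚ y := AlgebraicIndependent.of_comp L.val hv
  simpa using hy.cardinalMk_le_trdeg

/-- Two algebraically independent numbers ALGEBRAIC OVER `F_z` give `trdeg F_z ≥ 2`. -/
theorem two_le_trdeg_of_algebraicIndependent_of_isAlgebraic {ι : Type*} (z : ι → ℂ) {v : Fin 2 → ℂ}
    (hv : AlgebraicIndependent ℚ v)
    (halg : ∀ i, IsAlgebraic ↥(adjoin ℚ (Set.range z ∪ Set.range (cexp ∘ z))) (v i)) :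
    (2 : Cardinal) ≤ Algebra.trdeg ℚ ↥(adjoin ℚ (Set.range z ∪ Set.range (cexp ∘ z))) := by
  have h2 : (2 : Cardinal) ≤ Algebra.trdeg ℚ ↥(adjoin ℚ (Set.range v)) :=
    two_le_trdeg_of_algebraicIndependent hv (fun i => subset_adjoin ℚ _ ⟨i, rfl⟩)
  exact h2.trans (trdeg_adjoin_le_of_isAlgebraic (by rintro _ ⟨i, rfl⟩; exact halg i))

/-- **(L) THE LINDEMANN–WEIERSTRASS ENGINE** (hypothesis-free: tree theorem `algebraicIndependent_exp_holds`). -/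
theorem two_le_trdeg_of_lwRich {ι : Type*} (z : ι → ℂ) (h : LWRich z) :
    (2 : Cardinal) ≤ Algebra.trdeg ℚ ↥(adjoin ℚ (Set.range z ∪ Set.range (cexp ∘ z))) := by
  obtain ⟨b, hb, halg, hbF⟩ := h
  exact two_le_trdeg_of_algebraicIndependent_of_isAlgebraic z (algebraicIndependent_exp_holds b halg hb) hbF

/-- `π, e^π` are algebraically independent (as complex numbers), from Nesterenko's triple. -/
theorem algebraicIndependent_pi_exp_pi (hN : nesterenko) :
    AlgebraicIndependent ℚ ![(Real.pi : ℂ), cexp (Real.pi : ℂ)] := by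
  have h2 : AlgebraicIndependent ℚ ![Real.pi, Real.exp Real.pi] := by
    have h := hN.comp ![(0 : Fin 3), 1] (by decide)
    convert h using 1
    funext i; fin_cases i <;> rfl
  have e : (![(Real.pi : ℂ), cexp (Real.pi : ℂ)] : Fin 2 → ℂ) =
      (Complex.ofRealAm.restrictScalars ℚ) ∘ ![Real.pi, Real.exp Real.pi] := by
    funext i; fin_cases i <;> simp [Complex.ofReal_exp]
  rw [e]
  exact h2.map' Complex.ofReal_injective

/-- `π, e^{π√3}` are algebraically independent (as complex numbers), from Nesterenko's second triple. -/
theorem algebraicIndependent_pi_exp_pi_sqrt_three (hN' : nesterenko') :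
    AlgebraicIndependent ℚ ![(Real.pi : ℂ), cexp ((Real.pi : ℂ) * (Real.sqrt 3 : ℂ))] := by
  have h2 : AlgebraicIndependent ℚ ![Real.pi, Real.exp (Real.pi * Real.sqrt 3)] := by
    have h := hN'.comp ![(0 : Fin 3), 1] (by decide)
    convert h using 1
    funext i; fin_cases i <;> rfl
  have e : (![(Real.pi : ℂ), cexp ((Real.pi : ℂ) * (Real.sqrt 3 : ℂ))] : Fin 2 → ℂ) =
      (Complex.ofRealAm.restrictScalars ℚ) ∘ ![Real.pi, Real.exp (Real.pi * Real.sqrt 3)] := by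
    funext i; fin_cases i <;> simp [Complex.ofReal_exp]
  rw [e]
  exact h2.map' Complex.ofReal_injective

/-- **(N) THE NESTERENKO ENGINE** (mod the tree facts `nesterenko`, `nesterenko'`, both PROVED in the tree:
`nesterenko_holds`, `nesterenko'_holds`, module `PeriodsWave0NesterenkoProofs`, no farm olean at writing time). -/
theorem two_le_trdeg_of_periodRich (hN : nesterenko) (hN' : nesterenko') {ι : Type*} (z : ι → ℂ)
    (h : PeriodRich z) : (2 : Cardinal) ≤ Algebra.trdeg ℚ ↥(adjoin ℚ (Set.range z ∪ Set.range (cexp ∘ z))) := by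
  obtain ⟨hπ, h1 | h3⟩ := h
  · refine two_le_trdeg_of_algebraicIndependent_of_isAlgebraic z (algebraicIndependent_pi_exp_pi hN) ?_
    intro i; fin_cases i
    · exact hπ
    · exact h1
  · refine two_le_trdeg_of_algebraicIndependent_of_isAlgebraic z
      (algebraicIndependent_pi_exp_pi_sqrt_three hN') ?_
    intro i; fin_cases i
    · exact hπ
    · exact h3

/-- **EVERY ENGINE-RICH FIELD HAS `trdeg ≥ 2`, AT EVERY LENGTH** (mod the four tree facts, all PROVED in the tree). -/
theorem two_le_trdeg_of_engineRich (hBW : smallTrdeg_thm_2_9_two_two) (h29 : smallTrdeg_thm_2_9_pos)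
    (hN : nesterenko) (hN' : nesterenko') {ι : Type*} (z : ι → ℂ) (h : EngineRich z) :
    (2 : Cardinal) ≤ Algebra.trdeg ℚ ↥(adjoin ℚ (Set.range z ∪ Set.range (cexp ∘ z))) := by
  rcases h with hM | hL | hP
  · exact two_le_trdeg_of_moduleRich hBW h29 z hM
  · exact two_le_trdeg_of_lwRich z hL
  · exact two_le_trdeg_of_periodRich hN hN' z hP

/-- Hence the special piece is DECIDED at every length `n ≤ 3` (no sub-minimality needed). -/
theorem engineRichDefectOneAt_le_three (hBW : smallTrdeg_thm_2_9_two_two) (h29 : smallTrdeg_thm_2_9_pos)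
    (hN : nesterenko) (hN' : nesterenko') {n : ℕ} (hn : n ≤ 3) : EngineRichDefectOneAt n := by
  intro z _ hrich _
  have h2 := two_le_trdeg_of_engineRich hBW h29 hN hN' z hrich
  calc (n : Cardinal) ≤ (3 : Cardinal) := by exact_mod_cast hn
    _ = 2 + 1 := by norm_num
    _ ≤ _ := add_le_add h2 le_rfl

/-- The `n = 3` instances of the two NEW clauses are HYPOTHESIS-LIGHT: (L) is outright. -/
theorem defectOne_three_of_lwRich (z : Fin 3 → ℂ) (h : LWRich z) :
    (3 : Cardinal) ≤ Algebra.trdeg ℚ ↥(adjoin ℚ (Set.range z ∪ Set.range (cexp ∘ z))) + 1 :=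
  calc (3 : Cardinal) = 2 + 1 := by norm_num
    _ ≤ _ := add_le_add (two_le_trdeg_of_lwRich z h) le_rfl

/-- … and (N) needs only `nesterenko` / `nesterenko'`. -/
theorem defectOne_three_of_periodRich (hN : nesterenko) (hN' : nesterenko') (z : Fin 3 → ℂ) (h : PeriodRich z) :
    (3 : Cardinal) ≤ Algebra.trdeg ℚ ↥(adjoin ℚ (Set.range z ∪ Set.range (cexp ∘ z))) + 1 :=
  calc (3 : Cardinal) = 2 + 1 := by norm_num
    _ ≤ _ := add_le_add (two_le_trdeg_of_periodRich hN hN' z h) le_rfl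

/-! ## §4 THE TEETH THEOREM: from length 4 on, sub-minimality alone gives `trdeg ≥ 2`, so every engine is inert -/

/-- A sub-tuple of a ℚ-free tuple, re-indexed along `Fin.castLE`, is ℚ-free and lies in the span. -/
theorem linearIndependent_comp_castLE {m n : ℕ} (hmn : m ≤ n) {z : Fin n → ℂ} (hz : LinearIndependent ℚ z) :
    LinearIndependent ℚ (z ∘ Fin.castLE hmn) :=
  hz.comp _ (Fin.castLE_injective hmn)

/-- `trdeg F_z` of an `n`-tuple is a natural number `≤ 2n` (the field has `≤ 2n` generators). -/
theorem trdeg_eq_nat {n : ℕ} (z : Fin n → ℂ) :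
    ∃ t : ℕ, Algebra.trdeg ℚ ↥(adjoin ℚ (Set.range z ∪ Set.range (cexp ∘ z))) = t ∧ t ≤ n + n := by
  have hfin : Algebra.trdeg ℚ ↥(adjoin ℚ (Set.range z ∪ Set.range (cexp ∘ z))) ≤ ((n + n : ℕ) : Cardinal) := by
    refine trdeg_adjoin_le_nat _ ?_
    refine (Cardinal.mk_union_le _ _).trans ?_
    push_cast
    exact add_le_add (Cardinal.mk_range_le.trans (by simp)) (Cardinal.mk_range_le.trans (by simp))
  exact exists_nat_eq_of_le_natCast hfin

/-- **TEETH, part 1.**  At a sub-minimal ℚ-free `z` of length `n`, every `m < n` satisfies `m ≤ trdeg F_z + 1`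
(apply sub-minimality to the first `m` coordinates and monotonicity of `trdeg` in the span). Hypothesis-free. -/
theorem le_trdeg_add_one_of_subMinimal {n : ℕ} {z : Fin n → ℂ} (hz : LinearIndependent ℚ z)
    (hsub : SubMinimalDefect n z) {m : ℕ} (hm : m < n) :
    (m : Cardinal) ≤ Algebra.trdeg ℚ ↥(adjoin ℚ (Set.range z ∪ Set.range (cexp ∘ z))) + 1 := by
  have hw : ∀ j, (z ∘ Fin.castLE hm.le) j ∈ Submodule.span ℚ (Set.range z) :=
    fun j => Submodule.subset_span ⟨Fin.castLE hm.le j, rfl⟩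
  exact (hsub m (z ∘ Fin.castLE hm.le) hm (linearIndependent_comp_castLE hm.le hz) hw).trans
    (add_le_add (trdeg_le_of_mem_span hw) le_rfl)

/-- **TEETH, part 2.**  For `n ≥ 4`, a sub-minimal ℚ-free tuple has `trdeg F_z ≥ 2` OUTRIGHT — the common output
of every engine (M), (L), (N) is already implied by the induction hypothesis: the engine-domain special class has
teeth only at `n = 3`.  Hypothesis-free. -/
theorem two_le_trdeg_of_subMinimal {n : ℕ} (hn : 4 ≤ n) {z : Fin n → ℂ} (hz : LinearIndependent ℚ z)
    (hsub : SubMinimalDefect n z) :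
    (2 : Cardinal) ≤ Algebra.trdeg ℚ ↥(adjoin ℚ (Set.range z ∪ Set.range (cexp ∘ z))) := by
  have h3 := le_trdeg_add_one_of_subMinimal hz hsub (m := 3) (by omega)
  obtain ⟨t, ht, _⟩ := trdeg_eq_nat z
  rw [ht] at h3 ⊢
  have h3' : (3 : ℕ) ≤ t + 1 := by exact_mod_cast h3
  exact_mod_cast (show 2 ≤ t by omega)

/-- **TEETH, part 3 (first-failure exactness).**  A sub-minimal ℚ-free tuple of length `n` at which `S⁻` FAILS has
`trdeg F_z + 2 = n` exactly (and `n ≥ 3`): at a first failure one is always exactly ONE algebraically independent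
element short — at every length.  Hypothesis-free. -/
theorem trdeg_add_two_eq_of_firstFailure {n : ℕ} {z : Fin n → ℂ} (hz : LinearIndependent ℚ z)
    (hsub : SubMinimalDefect n z)
    (hfail : ¬ (n : Cardinal) ≤ Algebra.trdeg ℚ ↥(adjoin ℚ (Set.range z ∪ Set.range (cexp ∘ z))) + 1) :
    Algebra.trdeg ℚ ↥(adjoin ℚ (Set.range z ∪ Set.range (cexp ∘ z))) + 2 = n ∧ 3 ≤ n := by
  obtain ⟨t, ht, _⟩ := trdeg_eq_nat z
  have hn3 : 3 ≤ n := by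
    by_contra h
    exact hfail (defectOne_of_le_two n (by omega) z hz)
  have hm := le_trdeg_add_one_of_subMinimal hz hsub (m := n - 1) (by omega)
  rw [ht] at hfail hm ⊢
  have hm' : n - 1 ≤ t + 1 := by exact_mod_cast hm
  have hf' : ¬ n ≤ t + 1 := fun h => hfail (by exact_mod_cast h)
  refine ⟨?_, hn3⟩
  have : t + 2 = n := by omega
  exact_mod_cast this

/-- COROLLARY: from `n = 4` on, the rich layer and the type-free layer COINCIDE modulo nothing but logic once the
engines are granted — the engine hypothesis is inert (it is implied by sub-minimality up to `trdeg ≥ 2`, which every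
clause outputs and nothing more).  Precisely: `EngineRichDefectOneAt n` is implied by, and `EngineDarkDefectOneAt n`
together with it is equivalent to, `FirstFailureLayer n`; and a rich first failure of length `n ≥ 4` has exactly the
defect-2 shape of a dark one (`trdeg = n − 2 ≥ 2`). -/
theorem engineRich_firstFailure_shape {n : ℕ} (hn : 4 ≤ n) {z : Fin n → ℂ} (hz : LinearIndependent ℚ z)
    (hsub : SubMinimalDefect n z)
    (hfail : ¬ (n : Cardinal) ≤ Algebra.trdeg ℚ ↥(adjoin ℚ (Set.range z ∪ Set.range (cexp ∘ z))) + 1) :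
    (2 : Cardinal) ≤ Algebra.trdeg ℚ ↥(adjoin ℚ (Set.range z ∪ Set.range (cexp ∘ z))) ∧
      Algebra.trdeg ℚ ↥(adjoin ℚ (Set.range z ∪ Set.range (cexp ∘ z))) + 2 = n :=
  ⟨two_le_trdeg_of_subMinimal hn hz hsub, (trdeg_add_two_eq_of_firstFailure hz hsub hfail).1⟩

/-! ## §5 The LAYER-EXACT residual -/

/-- Layers `n ≤ 2` are decided (tree: `defectOne_of_le_two`). -/
theorem firstFailureLayer_le_two {n : ℕ} (hn : n ≤ 2) : FirstFailureLayer n :=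
  fun z hz _ => defectOne_of_le_two n hn z hz

/-- Layer 3 = its dark half (the rich half is decided, §5). -/
theorem firstFailureLayer_three_iff (hBW : smallTrdeg_thm_2_9_two_two) (h29 : smallTrdeg_thm_2_9_pos)
    (hN : nesterenko) (hN' : nesterenko') : FirstFailureLayer 3 ↔ EngineDarkDefectOneAt 3 := by
  rw [firstFailureLayer_iff_rich_and_dark]
  exact ⟨fun h => h.2, fun h => ⟨engineRichDefectOneAt_le_three hBW h29 hN hN' le_rfl, h⟩⟩

/-- At `n = 3` sub-minimality is automatic, so the dark layer is `S⁻` ON ENGINE-DARK ℚ-FREE TRIPLES. -/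
theorem engineDarkDefectOneAt_three_iff :
    EngineDarkDefectOneAt 3 ↔ ∀ z : Fin 3 → ℂ, LinearIndependent ℚ z → ¬ EngineRich z →
      (3 : Cardinal) ≤ Algebra.trdeg ℚ ↥(adjoin ℚ (Set.range z ∪ Set.range (cexp ∘ z))) + 1 :=
  ⟨fun h z hz hd => by exact_mod_cast h z hz hd (subMinimal_three z),
    fun h z hz hd _ => by exact_mod_cast h z hz hd⟩

/-- **THE LAYER-EXACT RESIDUAL.**  `S⁻ ⟺ (S⁻ on engine-dark ℚ-free triples) ∧ (∀ n ≥ 4, S⁻ at sub-minimal ℚ-free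
n-tuples)` — and by §6 no engine-domain hypothesis can be subtracted from the second conjunct. -/
theorem defectOne_iff_darkThree_and_fromFour (hBW : smallTrdeg_thm_2_9_two_two) (h29 : smallTrdeg_thm_2_9_pos)
    (hN : nesterenko) (hN' : nesterenko') :
    DefectOneSchanuel ↔ EngineDarkDefectOneAt 3 ∧ ∀ n, 4 ≤ n → FirstFailureLayer n := by
  rw [defectOne_iff_layers]
  refine ⟨fun h => ⟨(firstFailureLayer_three_iff hBW h29 hN hN').mp (h 3), fun n _ => h n⟩, fun ⟨h3, h4⟩ n => ?_⟩
  rcases Nat.lt_or_ge n 4 with hn | hn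
  · rcases Nat.lt_or_ge n 3 with hn3 | hn3
    · exact firstFailureLayer_le_two (by omega)
    · obtain rfl : n = 3 := by omega
      exact (firstFailureLayer_three_iff hBW h29 hN hN').mpr h3
  · exact h4 n hn

/-- The dark layers hold at all lengths iff from `3` on (layers `≤ 2` are decided). -/
theorem engineDarkAt_all_iff_from_three : (∀ n, EngineDarkDefectOneAt n) ↔ ∀ n, 3 ≤ n → EngineDarkDefectOneAt n := by
  refine ⟨fun h n _ => h n, fun h n => ?_⟩
  rcases Nat.lt_or_ge n 3 with hn | hn
  · exact fun z hz _ _ => defectOne_of_le_two n (by omega) z hz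
  · exact h n hn

/-- The rich layers hold at all lengths iff from `4` on (mod the engines) — where, by §6, the hypothesis is inert. -/
theorem engineRichAt_all_iff_from_four (hBW : smallTrdeg_thm_2_9_two_two) (h29 : smallTrdeg_thm_2_9_pos)
    (hN : nesterenko) (hN' : nesterenko') : (∀ n, EngineRichDefectOneAt n) ↔ ∀ n, 4 ≤ n → EngineRichDefectOneAt n := by
  refine ⟨fun h n _ => h n, fun h n => ?_⟩
  rcases Nat.lt_or_ge n 4 with hn | hn
  · exact engineRichDefectOneAt_le_three hBW h29 hN hN' (by omega)
  · exact h n hn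

/-- … and those layers are implied by the type-free layers: the rich side is a CONSEQUENCE of
`∀ n ≥ 4, FirstFailureLayer n` (it adds nothing to the residual side from length 4 on). -/
theorem engineRichAt_all_of_fromFour (hBW : smallTrdeg_thm_2_9_two_two) (h29 : smallTrdeg_thm_2_9_pos)
    (hN : nesterenko) (hN' : nesterenko') (h4 : ∀ n, 4 ≤ n → FirstFailureLayer n) : ∀ n, EngineRichDefectOneAt n :=
  (engineRichAt_all_iff_from_four hBW h29 hN hN').mpr fun n hn z hz _ hs => h4 n hn z hz hs

end Summit.Schanuel.Schanuel.Theorems.RootDecomp1EEngineType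

end
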